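import Mathlib
import Summits.ValiantsHypothesis.ValiantsHypothesis.Theorems.LacunarySymmetroidMatrixDescartesWLawTwoWitness

/-!
# `MatrixDescartes` (stmt-ValiantsHypothesis-18050) — the W-LAW, a TYPED candidate for the first K-dependent
# two-sided instance beyond the V1 engines (desk R1490 / R1515 (1)); NOT asserted

HONEST FRAMING.  Cell `pub-symmetroid`, seat `val-sym-mdr-p2` (gen 4); bookkeeping file `--supports` the crux
`Theses.LacunarySymmetroid.MatrixDescartes`.  It TYPES one conjectural sector law as a named `Prop` (never asserted,
never used as a hypothesis of anything landed) together with its kernel calibration; nothing here bears on the crux, on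
`stub_twoSided`, on `DoorA26` / `DoorA34`, or on `VP ≠ VNP`.

THE W-CONFIGURATION.  A pivot pencil `X^e J + X^{d₁} P₁ + X^{d₂} P₂ + X^{d₃} Q` with `d₂ < d₁ < e < d₃`, `J` real
symmetric (any signature), `P₁, P₂, Q ⪰ 0`: TWO positive semidefinite letters below the pivot, ONE above.  The
V-configuration (one PSD letter on each side) obeys the K-free law `Z₊ ≤ 2·card ι` for all gaps (tree `stub_vLaw`,
`VLawCore.core_pos`); the W-configuration does NOT: `not_wLaw_two` (tree `…WLawTwoWitness`) has `Z₊ = 6 = 3·2` at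
`card ι = 2`, gaps `(1, 3 | 2)`.  The signed fan law covers W only when the gaps fall in the signed closed window
(`a₂ ≤ b`, or `a₂ ≤ 2a₁ ∧ b ≤ a₁`, seat memo SIGNED-FAN-LAW §2); the Loewner / regime-window engines of gen 4 cover it
only when the pivot letter is negative semidefinite and dominant (`dominantMiddle`).  With an INDEFINITE pivot and gaps
outside the window the W-configuration is outside every engine in the tree (desk R1533: «the first named MatrixDescartes
instance beyond both V1 engines»).

THE TYPED CANDIDATE (`WLaw`, NOT asserted): `Z₊ ≤ 3·card ι` for every W-configuration, every size, all gaps.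
STATUS: OPEN.  Calibration in the kernel: `not_wLaw_sharper` — the constant `3` cannot be lowered to `2`
(`not_wLaw_two`); at `card ι = 1` the bound is Descartes' (sign pattern `+ + ? +`, at most two changes); the smallest
open instance is `card ι = 2` (`WLawAt 2`: located value 6 on `(1,3 | 2)`; Descartes allows 8 on `(2,6 | 5)`, i.e.
exponents `(0,4 | 6 | 11)`; engine-2 g23's climbers found ≤ 4 there but under-shoot free-letter controls, R1515).
CAVEAT (seat memo SIGNED-FAN-LAW §3): laws linear in `card ι` with a per-configuration constant must fail for SOME
configurations with many letters if the `(m,3)` column stays Descartes-extremal (lifted A3 rows); that mechanism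
produces 7-letter words, not the 4-letter W shape, so it does not bear on `WLaw` as typed.
[conjecture of the cell (desk R1490, seat val-sym-mdr-p2 g4); no citation exists]
-/

-- layout Summits/ValiantsHypothesis/ValiantsHypothesis forces the duplicated namespace component
set_option linter.dupNamespace false

namespace Summit.ValiantsHypothesis.ValiantsHypothesis.Theorems.LacunarySymmetroidMatrixDescartes

open Polynomial Matrix Finset
open scoped BigOperators

/-- **W-law at size `n` with budget `B`** (typed row, NOT asserted): every `n × n` W-configuration
`X^e J + X^{d₁} P₁ + X^{d₂} P₂ + X^{d₃} Q` (`d₂ < d₁ < e < d₃`; `J` real symmetric; `P₁, P₂, Q ⪰ 0`) has at most `B`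
distinct positive zeros of its determinant.  [conjecture-shaped definition of the cell (desk R1490, seat
val-sym-mdr-p2 g4); no citation exists] -/
def WLawAt (n B : ℕ) : Prop :=
  ∀ (e d₁ d₂ d₃ : ℕ) (J P₁ P₂ Q : Matrix (Fin n) (Fin n) ℝ), J.IsSymm →
    P₁.PosSemidef → P₂.PosSemidef → Q.PosSemidef → d₂ < d₁ → d₁ < e → e < d₃ →
    ((Matrix.det (((Polynomial.X : Polynomial ℝ) ^ e) • J.map Polynomial.C
        + ((Polynomial.X : Polynomial ℝ) ^ d₁) • P₁.map Polynomial.C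
        + ((Polynomial.X : Polynomial ℝ) ^ d₂) • P₂.map Polynomial.C
        + ((Polynomial.X : Polynomial ℝ) ^ d₃) • Q.map Polynomial.C)).roots.toFinset.filter
          (fun t => 0 < t)).card ≤ B

/-- **THE W-LAW** (typed candidate for the first K-dependent two-sided law beyond the V1 engines; NOT asserted;
STATUS: OPEN, smallest open instance `n = 2`): `Z₊ ≤ 3n` for every W-configuration of every size `n`.
[conjecture of the cell (desk R1490, seat val-sym-mdr-p2 g4); no citation exists] -/
def WLaw : Prop := ∀ n : ℕ, WLawAt n (3 * n)

/-- Rows are monotone in the budget. [bookkeeping] -/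
theorem wLawAt_mono {n B B' : ℕ} (h : WLawAt n B) (hB : B ≤ B') : WLawAt n B' :=
  fun e d₁ d₂ d₃ J P₁ P₂ Q hJ h₁ h₂ h₃ h₄ h₅ h₆ => (h e d₁ d₂ d₃ J P₁ P₂ Q hJ h₁ h₂ h₃ h₄ h₅ h₆).trans hB

/-- **Calibration: the constant `3` cannot be lowered to `2`** — the row `WLawAt 2 4` (`4 = 2·2`) is FALSE: the
tree's kernel witness of `…WLawTwoWitness` (`e = 3`, `(d₁,d₂,d₃) = (2,0,5)`, i.e. gaps `(1, 3 | 2)`, symmetric `J`,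
rank-≤ 2 PSD letters) has at least six positive zeros (`WLawTwoWitness.six_le_card_posRoots_Fw`). [folklore] -/
theorem not_wLawAt_two_four : ¬ WLawAt 2 4 := by
  intro h
  have h6 := WLawTwoWitness.six_le_card_posRoots_Fw
  have hJ : (!![620, -260; -260, -2720] : Matrix (Fin 2) (Fin 2) ℝ).IsSymm :=
    Matrix.IsSymm.ext fun i j => by fin_cases i <;> fin_cases j <;> simp
  have h4 := h 3 2 0 5 (!![620, -260; -260, -2720] : Matrix (Fin 2) (Fin 2) ℝ)
    (Matrix.vecMulVec ![(20 : ℝ), 38] ![(20 : ℝ), 38] : Matrix (Fin 2) (Fin 2) ℝ)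
    (Matrix.vecMulVec ![(20 : ℝ), 32] ![(20 : ℝ), 32]
      + Matrix.vecMulVec ![(15 : ℝ), 23] ![(15 : ℝ), 23] : Matrix (Fin 2) (Fin 2) ℝ)
    (Matrix.vecMulVec ![(-9 : ℝ), 20] ![(-9 : ℝ), 20]
      + Matrix.vecMulVec ![(-6 : ℝ), 13] ![(-6 : ℝ), 13] : Matrix (Fin 2) (Fin 2) ℝ)
    hJ WLawTwoWitness.Pw₁_posSemidef WLawTwoWitness.Pw₂_posSemidef WLawTwoWitness.Qw_posSemidef
    (by norm_num) (by norm_num) (by norm_num)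
  exact absurd (h6.trans h4) (by norm_num)

/-- Hence `WLaw` is sharp at `n = 2` if true: `WLawAt 2 B` fails for every `B ≤ 4`. [bookkeeping] -/
theorem not_wLawAt_two_of_le_four {B : ℕ} (hB : B ≤ 4) : ¬ WLawAt 2 B :=
  fun h => not_wLawAt_two_four (wLawAt_mono h hB)

end Summit.ValiantsHypothesis.ValiantsHypothesis.Theorems.LacunarySymmetroidMatrixDescartes
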